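import Summits.CriticalPhenomena.PercolationContinuityZ3.Theorems.PercNearOneGluingNoHeavyLowerTailThreePointPiecesClasses
import HarnessLib

/-!
# `(3PT)` for three terminals joined pairwise by arbitrary two-terminal networks — every finite weighted graph of this shape

Support file for crux `stmt-CriticalPhenomena-4575` (`NoHeavyLowerTail`), seat `prim-l12-p1` gen 20 (`--supports stmt-CriticalPhenomena-4575`);
a piece-language-free corollary of `threePointVariance_of_hubs_and_series` (`…ThreePointPiecesClasses.lean`).
Memo `run/shared/lean/prim/prim-l12/FROM-prim-l12-p1-g20-PARALLEL-PIECES.md` §1.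

**Theorem** (`threePointVariance_threeNetworks`) [this work].  Let the non-terminal vertices of a finite weighted graph be split into three
sets `Pab, Pac, Pbc` such that no pair joins two different sets, `Pab` is not joined to `c`, `Pac` not to `b`, `Pbc` not to `a` — i.e. the graph
is the union of three arbitrary two-terminal networks `N_ab ⊇ Pab`, `N_ac ⊇ Pac`, `N_bc ⊇ Pbc` on the pairs `{a,b}`, `{a,c}`, `{b,c}`, sharing only
the terminals (terminal–terminal pairs arbitrary; this is the "Δ-network" / generalized triangle).  Then the three-point variance row holds:
`P(a↔b)·P(a↮b) ≤ P(a↔b, a↮c) + P(a↔c, a↮b) + P(b↔c, a↮b)`.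
Proof: each of the three sets is a SERIES PIECE of the piece structure `part = (Pab ↦ 0, Pac ↦ 1, rest ↦ 2)`.
-/

namespace Summit.CriticalPhenomena.PercolationContinuityZ3.Theorems.ThreePointPieces

open MeasureTheory Set
open Literature.Probability.Percolation Literature.Probability.LatticeModels

variable {V : Type*} [Fintype V] [DecidableEq V]

/-- **`(3PT)` on the generalized triangle**: three terminals pairwise joined by arbitrary vertex-disjoint two-terminal networks. [this work] -/
theorem threePointVariance_threeNetworks (w : Sym2 V → unitInterval) {a b c : V} (hab : a ≠ b) (hac : a ≠ c) (hbc : b ≠ c)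
    (Pab Pac Pbc : Finset V) (hcover : ∀ v, v ∉ terms a b c → v ∈ Pab ∨ v ∈ Pac ∨ v ∈ Pbc)
    (hPab : ∀ v ∈ Pab, v ∉ Pac ∧ v ∉ Pbc) (hPac : ∀ v ∈ Pac, v ∉ Pbc)
    (h01 : ∀ u ∈ Pab, ∀ v ∈ Pac, (w s(u, v) : ℝ) = 0) (h02 : ∀ u ∈ Pab, ∀ v ∈ Pbc, (w s(u, v) : ℝ) = 0)
    (h12 : ∀ u ∈ Pac, ∀ v ∈ Pbc, (w s(u, v) : ℝ) = 0)
    (hc' : ∀ u ∈ Pab, (w s(u, c) : ℝ) = 0) (hb' : ∀ u ∈ Pac, (w s(u, b) : ℝ) = 0) (ha' : ∀ u ∈ Pbc, (w s(u, a) : ℝ) = 0) :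
    (prodBernoulli w).real (openConn a b) * (prodBernoulli w).real (openConn a b)ᶜ ≤
      (prodBernoulli w).real (openConn a b ∩ (openConn a c)ᶜ) + (prodBernoulli w).real (openConn a c ∩ (openConn a b)ᶜ) +
        (prodBernoulli w).real (openConn b c ∩ (openConn a b)ᶜ) := by
  -- the piece structure
  let part : V → Fin 3 := fun v => if v ∈ Pab then 0 else if v ∈ Pac then 1 else 2
  have p0 : ∀ {v}, v ∉ terms a b c → (part v = 0 ↔ v ∈ Pab) := by
    intro v hv
    constructor
    · intro h
      by_contra hn
      by_cases h1 : v ∈ Pac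
      · simp [part, hn, h1] at h
      · simp [part, hn, h1] at h
    · intro h; simp [part, h]
  have p1 : ∀ {v}, v ∉ terms a b c → (part v = 1 ↔ v ∈ Pac) := by
    intro v hv
    constructor
    · intro h
      by_contra hn
      by_cases h0 : v ∈ Pab
      · simp [part, h0] at h
      · simp [part, h0, hn] at h
    · intro h
      have h0 : v ∉ Pab := fun h0 => (hPab v h0).1 h
      simp [part, h0, h]
  have p2 : ∀ {v}, v ∉ terms a b c → (part v = 2 ↔ v ∈ Pbc) := by
    intro v hv
    constructor
    · intro h
      by_cases h0 : v ∈ Pab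
      · simp [part, h0] at h
      · by_cases h1' : v ∈ Pac
        · simp [part, h0, h1'] at h
        · rcases hcover v hv with h' | h' | h'
          · exact (h0 h').elim
          · exact (h1' h').elim
          · exact h'
    · intro h
      have h0 : v ∉ Pab := fun h0 => (hPab v h0).2 h
      have h1' : v ∉ Pac := fun h1' => hPac v h1' h
      simp [part, h0, h1']
  refine threePointVariance_of_hubs_and_series w hab hac hbc part ?_ ?_
  · -- no pair between different pieces
    intro u v hu hv huv
    rcases hcover u hu with hu' | hu' | hu' <;> rcases hcover v hv with hv' | hv' | hv'
    · exact (huv (((p0 hu).2 hu').trans ((p0 hv).2 hv').symm)).elim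
    · exact h01 u hu' v hv'
    · exact h02 u hu' v hv'
    · rw [Sym2.eq_swap]; exact h01 v hv' u hu'
    · exact (huv (((p1 hu).2 hu').trans ((p1 hv).2 hv').symm)).elim
    · exact h12 u hu' v hv'
    · rw [Sym2.eq_swap]; exact h02 v hv' u hu'
    · rw [Sym2.eq_swap]; exact h12 v hv' u hu'
    · exact (huv (((p2 hu).2 hu').trans ((p2 hv).2 hv').symm)).elim
  · -- every piece is a series piece
    intro i
    right
    fin_cases i
    · -- `Pab`: middle `a`, the whole piece on the `b`-side (`X = univ`), `c`-side empty
      refine ⟨Finset.univ, Or.inr (Or.inl fun u v hu hv huv => ?_)⟩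
      rcases huv with ⟨huT, hui, -⟩ | ⟨-, -, hvX⟩
      · have huP : u ∈ Pab := (p0 huT).1 hui
        rcases hv with rfl | ⟨-, -, hvX⟩
        · exact hc' u huP
        · exact (hvX (Finset.mem_univ _)).elim
      · exact (hvX (Finset.mem_univ _)).elim
    · -- `Pac`: middle `a`, `b`-side empty (`X = ∅`), the whole piece on the `c`-side
      refine ⟨∅, Or.inr (Or.inl fun u v hu hv huv => ?_)⟩
      rcases huv with ⟨-, -, huX⟩ | ⟨hvT, hvi, -⟩
      · exact (Finset.notMem_empty _ huX).elim
      · have hvP : v ∈ Pac := (p1 hvT).1 hvi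
        rcases hu with rfl | ⟨-, -, huX⟩
        · rw [Sym2.eq_swap]; exact hb' v hvP
        · exact (Finset.notMem_empty _ huX).elim
    · -- `Pbc` (label 2): middle `c`, `a`-side empty, the whole piece on the `b`-side
      refine ⟨∅, Or.inl fun u v hu hv huv => ?_⟩
      rcases huv with ⟨-, -, huX⟩ | ⟨hvT, hvi, -⟩
      · exact (Finset.notMem_empty _ huX).elim
      · have hvP : v ∈ Pbc := (p2 hvT).1 hvi
        rcases hu with rfl | ⟨-, -, huX⟩
        · rw [Sym2.eq_swap]; exact ha' v hvP
        · exact (Finset.notMem_empty _ huX).elim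

end Summit.CriticalPhenomena.PercolationContinuityZ3.Theorems.ThreePointPieces
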